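import Literature.NumberTheory.EllipticCurves.CastellaLiuWan2022.GreenbergDivisibilityAwayFromCyclotomic
import Literature.NumberTheory.EllipticCurves.CastellaGrossiSkinner2025.TwoVariablePAdicLFunctionII
import HarnessLib

/-!
# Castella–Liu–Wan 2022 (Forum Math. Sigma 10, e110), Thm. 8.2.1 in E-currency — PROVED API of the
# value frame `IsCastellaLiuWanLFunction₂` and the "direct comparison of the interpolation displays"
# with Castella's / Hsieh's anticyclotomic displays on the line `b = m = n` (companion of
# `GreenbergDivisibilityAwayFromCyclotomic.lean`; theorems only, no named fact, no definition)

Typed by the literature seat `bsd-addord-ty-clw1` (cell `pub/bsd-addord`). The statement file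
`GreenbergDivisibilityAwayFromCyclotomic.lean` (module docstring there: source of record, the E-reading
(E)–(V)–(O)–(S)–(T), what is NOT in print) holds the definitions `clwInterpolationValue`,
`IsCastellaLiuWanLFunction₂`, `IsEulerFactorAway₂` and the two named facts; this file PROVES:
* the diagonal form of the CLW display and its comparison with `bdpInterpolationValue` (Castella 2018
  Thm. 3.1) and `hsiehInterpolationValue` (Hsieh 2014 Thm. A) at a level `N` with `p ∣ N`, `a_p = 0`
  (the additive curve `E = V ⊗ χ_{p*}`): the CLW display is the other one times the EXPLICIT factor
  `ρ(ϖ_𝔭′)⁻² × (constant) × (constant)^{n}` — "a direct comparison of the interpolation properties" (the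
  phrase of [BCS25, proof of Prop. 4.2.2]) at the level of displays; NOTHING about elements or ideals
  (the anticyclotomic-restriction sentence for this branch is NOT in print — statement file, "NOT typed");
* unfolding lemmas of `IsCastellaLiuWanLFunction₂` / `IsEulerFactorAway₂` and their reading on the line
  `T₁ = 0` for characters through the anticyclotomic `κ₂` (where the tree's one-variable frames live):
  `hasValueAt_constantCoeff_of_euler` (the `S`-imprimitive display of `A(0,·) = constantCoeff A` in the
  `IntSeries.HasValueAt` currency of `IsBDPLFunction` / `IsHsiehLFunction`) and its two rewritings
  `…_eq_mul_bdp` / `…_eq_mul_hsieh` through the display comparisons (value by value; no ideal statement).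
Imports `CastellaGrossiSkinner2025.TwoVariablePAdicLFunctionII` only for the proved evaluation lemma
`IntSeries.HasValueAt₂.const_mul`. BSD is proved for no curve by any of this.

## References
* [CastellaLiuWan2022] Forum Math. Sigma 10 (2022) e110, (1.0.3) p. 3, (6.1.2) p. 51, Thm. 8.2.1 p. 85.
* [Castella2018] CJM 6 (2018) Thm. 3.1 (`bdpInterpolationValue`). [Hsieh2014] Doc. Math. 19, Thm. A
  (`hsiehInterpolationValue`). [BurungaleCastellaSkinner2025] IMRN 2025, proof of Prop. 4.2.2 (the phrase).
-/

noncomputable section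

open scoped Classical

open PowerSeries NumberField IsDedekindDomain Field CongruenceSubgroup
  Literature.NumberTheory.GaloisRepresentations Literature.NumberTheory.EllipticCurves
  Literature.NumberTheory.EllipticCurves.ModularForms

namespace Literature.NumberTheory.EllipticCurves.CastellaLiuWan2022

universe u

variable {K : Type u} [Field K] [NumberField K] {N : ℕ}

/-! ## §A. The display on the anticyclotomic line and the direct comparisons -/

/-- On the anticyclotomic line `b = m = n` the CLW display reads
`Γ(n+1)Γ(n) · ρ(ϖ_𝔭′)⁻² · L(f/K,ρ,1) · C / ((2πi)^{2n+1} Ω_∞^{4n})`.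
[cite: CastellaLiuWan2022, (1.0.3) p. 3 (Forum Math. Sigma 10 (2022) e110)] -/
theorem clwInterpolationValue_diag (f : CuspForm (Gamma0 N) 2) (𝔭' : HeightOneSpectrum (𝓞 K))
    (ρ : HeckeCharacter K) (n : ℕ) (Ωinf C : ℂ) :
    clwInterpolationValue f 𝔭' ρ n n Ωinf C =
      Complex.Gamma (n + 1) * Complex.Gamma n * ((heckeValueExtZero ρ 𝔭') ^ 2)⁻¹ *
          rankinSelbergValueHecke f ρ 1 * C /
        ((2 * Real.pi * Complex.I) ^ (2 * n + 1) * Ωinf ^ (4 * n)) := by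
  simp only [clwInterpolationValue]
  ring_nf

/-- **Direct comparison of the interpolation displays on the anticyclotomic line, I (Castella's
normalisation).** At a level `N` with `p ∣ N` and `a_p(f) = 0` (the ADDITIVE curve `E`: `p² ∣ N_E`,
`a_p(E) = 0`), Castella's display `bdpInterpolationValue p f 𝔭 ρ n Ω_K = Γ(n)Γ(n+1) · 1 · L(f/K,ρ,1) /
(π^{2n+1} Ω_K^{4n})` (Euler polynomial `1 − a_p p⁻¹ x + e_p x² = 1`) and the CLW display differ by the
EXPLICIT factor `ρ(ϖ_𝔭′)⁻² · C · π^{2n+1} Ω_K^{4n} / ((2πi)^{2n+1} Ω_∞^{4n})` — "a direct comparison of the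
interpolation properties" (the phrase of [BCS25, proof of Prop. 4.2.2]) at the level of displays; the
factor is `ρ(ϖ_𝔭′)⁻²` (for anticyclotomic `ρ` of conductor `1`: `= ρ(ϖ_𝔭)²`, `p`-adic valuation `2n`)
times `(constant)·(constant)^{n}`. Nothing about elements or ideals is claimed.
[cite: CastellaLiuWan2022, (1.0.3) p. 3 (Forum Math. Sigma 10 (2022) e110)] [cite: Castella2018, Thm. 3.1 (arXiv:1704.06608 p. 9)] -/
theorem clwInterpolationValue_diag_eq_mul_bdpInterpolationValue {p : ℕ} (hpN : p ∣ N)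
    (f : CuspForm (Gamma0 N) 2) (hap : cuspCoeff f p = 0) (𝔭 𝔭' : HeightOneSpectrum (𝓞 K))
    (ρ : HeckeCharacter K) (n : ℕ) {Ωinf ΩK : ℂ} (hΩK : ΩK ≠ 0) (C : ℂ) :
    clwInterpolationValue f 𝔭' ρ n n Ωinf C =
      ((heckeValueExtZero ρ 𝔭') ^ 2)⁻¹ * C * ((Real.pi : ℂ) ^ (2 * n + 1) * ΩK ^ (4 * n)) /
          ((2 * Real.pi * Complex.I) ^ (2 * n + 1) * Ωinf ^ (4 * n)) *
        bdpInterpolationValue p f 𝔭 ρ n ΩK := by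
  have hπ : (Real.pi : ℂ) ≠ 0 := Complex.ofReal_ne_zero.mpr Real.pi_ne_zero
  have hden : (Real.pi : ℂ) ^ (2 * n + 1) * ΩK ^ (4 * n) ≠ 0 :=
    mul_ne_zero (pow_ne_zero _ hπ) (pow_ne_zero _ hΩK)
  rw [clwInterpolationValue_diag, bdpInterpolationValue]
  simp only [hpN, if_true, hap, zero_mul, sub_zero, add_zero, one_pow, mul_one]
  field_simp

/-- **Direct comparison of the interpolation displays on the anticyclotomic line, II (Hsieh's
display).** With `p ∣ N`, `a_p(f) = 0` and Hsieh's constants `A > 0`, `Ω_K ≠ 0`, `C′`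
(`hsiehInterpolationValue p f 𝔭 ρ n A Ω_K C′ = Γ(n)Γ(n+1) · p^{n} · 1 · L · C′ / (A^{2n} 4^{2n} π^{2n+1}
Ω_K^{4n})`): the CLW display is Hsieh's times the explicit factor
`ρ(ϖ_𝔭′)⁻² · C · A^{2n} 4^{2n} π^{2n+1} Ω_K^{4n} / (p^{n} · C′ · (2πi)^{2n+1} Ω_∞^{4n})`.
[cite: CastellaLiuWan2022, (1.0.3) p. 3 (Forum Math. Sigma 10 (2022) e110)] [cite: Hsieh2014, Thm. A p. 712 (Doc. Math. 19) = Thm. 1 (arXiv:1112.1580 p. 4)] -/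
theorem clwInterpolationValue_diag_eq_mul_hsiehInterpolationValue {p : ℕ} (hp : p ≠ 0) (hpN : p ∣ N)
    (f : CuspForm (Gamma0 N) 2) (hap : cuspCoeff f p = 0) (𝔭 𝔭' : HeightOneSpectrum (𝓞 K))
    (ρ : HeckeCharacter K) (n : ℕ) {A : ℝ} (hA : 0 < A) {Ωinf ΩK C' : ℂ} (hΩK : ΩK ≠ 0)
    (hC' : C' ≠ 0) (C : ℂ) :
    clwInterpolationValue f 𝔭' ρ n n Ωinf C =
      ((heckeValueExtZero ρ 𝔭') ^ 2)⁻¹ * C *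
            ((A : ℂ) ^ (2 * n) * (4 : ℂ) ^ (2 * n) * (Real.pi : ℂ) ^ (2 * n + 1) * ΩK ^ (4 * n)) /
          (((p : ℂ) ^ n * C') * ((2 * Real.pi * Complex.I) ^ (2 * n + 1) * Ωinf ^ (4 * n))) *
        hsiehInterpolationValue p f 𝔭 ρ n A ΩK C' := by
  have hπ : (Real.pi : ℂ) ≠ 0 := Complex.ofReal_ne_zero.mpr Real.pi_ne_zero
  have hA' : (A : ℂ) ≠ 0 := Complex.ofReal_ne_zero.mpr hA.ne'
  have hp' : (p : ℂ) ≠ 0 := Nat.cast_ne_zero.mpr hp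
  have h4 : (4 : ℂ) ≠ 0 := by norm_num
  rw [clwInterpolationValue_diag, hsiehInterpolationValue]
  simp only [hpN, if_true, hap, zero_mul, sub_zero, add_zero, one_pow, mul_one]
  field_simp

/-! ## §B. Unfolding the frame -/

section API

variable {p : ℕ} [Fact p.Prime]

variable {ι : PadicAlgCl p ≃+* ℂ} {𝔭' : HeightOneSpectrum (𝓞 K)} {κ₁ κ₂ : ZpExtension K p}
  {g₁ g₂ : absoluteGaloisGroup K} {f : CuspForm (Gamma0 N) 2} {Ωinf C : ℂ} {Ωp : ℂ_[p]}
  {A B : PowerSeries (PowerSeries (PadicComplexInt p))}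

/-- Unfolding `IsCastellaLiuWanLFunction₂` at one character of the typed range: the prescribed value of
`A` at `(r(g₁) − 1, r(g₂) − 1)` given a value `v_B` of `B` there.
[cite: CastellaLiuWan2022, (1.0.3) p. 3 (Forum Math. Sigma 10 (2022) e110)] -/
theorem IsCastellaLiuWanLFunction₂.hasValueAt₂
    (hAB : IsCastellaLiuWanLFunction₂ ι 𝔭' κ₁ κ₂ g₁ g₂ f Ωinf C Ωp A B)
    {ρ : HeckeCharacter K} {m b : ℕ} (hm : 1 ≤ m) (hmb : m ≤ b)
    (hinf : ρ.HasInfinityType (fun _ ↦ (m : ℤ)) (fun _ ↦ -(b : ℤ)))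
    (hunr : ∀ w : HeightOneSpectrum (𝓞 K), ρ.IsUnramifiedAt w)
    {r : FramedGaloisRep K (PadicAlgCl p) 1} (hr : IsPAdicAvatarOf ι ρ r)
    (hκ : FactorsThroughPair κ₁ κ₂ r) {vB : ℂ_[p]}
    (hvB : IntSeries.HasValueAt₂ B (avatarValueAt r g₁ - 1) (avatarValueAt r g₂ - 1) vB) :
    IntSeries.HasValueAt₂ A (avatarValueAt r g₁ - 1) (avatarValueAt r g₂ - 1)
      (vB * (((ι.symm (clwInterpolationValue f 𝔭' ρ m b Ωinf C) : PadicAlgCl p) : ℂ_[p]) *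
        Ωp ^ (2 * (b + m)))) :=
  hAB ρ m b hm hmb hinf hunr r hr hκ vB hvB

/-- The value of `A` at a point of the range is determined by the value of `B` there (values are
`HasSum` limits in the Hausdorff space `ℂ_p`).
[cite: CastellaLiuWan2022, (1.0.3) p. 3 (Forum Math. Sigma 10 (2022) e110)] -/
theorem IsCastellaLiuWanLFunction₂.eq_of_hasValueAt₂
    (hAB : IsCastellaLiuWanLFunction₂ ι 𝔭' κ₁ κ₂ g₁ g₂ f Ωinf C Ωp A B)
    {ρ : HeckeCharacter K} {m b : ℕ} (hm : 1 ≤ m) (hmb : m ≤ b)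
    (hinf : ρ.HasInfinityType (fun _ ↦ (m : ℤ)) (fun _ ↦ -(b : ℤ)))
    (hunr : ∀ w : HeightOneSpectrum (𝓞 K), ρ.IsUnramifiedAt w)
    {r : FramedGaloisRep K (PadicAlgCl p) 1} (hr : IsPAdicAvatarOf ι ρ r)
    (hκ : FactorsThroughPair κ₁ κ₂ r) {vB vA : ℂ_[p]}
    (hvB : IntSeries.HasValueAt₂ B (avatarValueAt r g₁ - 1) (avatarValueAt r g₂ - 1) vB)
    (hvA : IntSeries.HasValueAt₂ A (avatarValueAt r g₁ - 1) (avatarValueAt r g₂ - 1) vA) :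
    vA = vB * (((ι.symm (clwInterpolationValue f 𝔭' ρ m b Ωinf C) : PadicAlgCl p) : ℂ_[p]) *
      Ωp ^ (2 * (b + m))) :=
  hvA.unique (hAB.hasValueAt₂ hm hmb hinf hunr hr hκ hvB)

/-- On the ANTICYCLOTOMIC line: a character whose avatar factors through `κ₂` alone factors through
the pair, and if `g₁ ∈ ker κ₂` (the first member of a completing pair of `(κ₂, g₂)`) the frame is read
at the point `(0, r(g₂) − 1)` — the line `T₁ = 0` of `𝒪_{ℂ_p}⟦T₂⟧⟦T₁⟧`, on which the one-variable
anticyclotomic frames of the tree (`IsBDPLFunction`, `IsHsiehLFunction` at the generator `g₂`) live.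
[cite: CastellaLiuWan2022, Thm. 8.2.1 p. 85 (Γ⁺_𝒦 and 𝓡, display (8.2.1)) (Forum Math. Sigma 10 (2022) e110)] -/
theorem IsCastellaLiuWanLFunction₂.hasValueAt₂_line
    (hAB : IsCastellaLiuWanLFunction₂ ι 𝔭' κ₁ κ₂ g₁ g₂ f Ωinf C Ωp A B) (hg₁ : κ₂ g₁ = 1)
    {ρ : HeckeCharacter K} {n : ℕ} (hn : 1 ≤ n)
    (hinf : ρ.HasInfinityType (fun _ ↦ (n : ℤ)) (fun _ ↦ -(n : ℤ)))
    (hunr : ∀ w : HeightOneSpectrum (𝓞 K), ρ.IsUnramifiedAt w)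
    {r : FramedGaloisRep K (PadicAlgCl p) 1} (hr : IsPAdicAvatarOf ι ρ r)
    (hκ : FactorsThroughZp κ₂ r) {vB : ℂ_[p]}
    (hvB : IntSeries.HasValueAt₂ B 0 (avatarValueAt r g₂ - 1) vB) :
    IntSeries.HasValueAt₂ A 0 (avatarValueAt r g₂ - 1)
      (vB * (((ι.symm (clwInterpolationValue f 𝔭' ρ n n Ωinf C) : PadicAlgCl p) : ℂ_[p]) *
        Ωp ^ (2 * (n + n)))) := by
  have h1 : avatarValueAt r g₁ - 1 = 0 := by
    rw [avatarValueAt_eq_one_of_factorsThroughZp hκ hg₁, sub_self]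
  have h := hAB.hasValueAt₂ hn le_rfl hinf hunr hr (hκ.factorsThroughPair_right κ₁) (vB := vB)
    (by rw [h1]; exact hvB)
  rwa [h1] at h

/-- Unfolding `IsEulerFactorAway₂` at one character of the typed range: the value of the Euler-factor
element at `(r(g₁) − 1, r(g₂) − 1)` is `ι⁻¹(∏_{w∈S} P_w(f, ρ, 1))`.
[cite: CastellaLiuWan2022, (6.1.2) p. 51 (Forum Math. Sigma 10 (2022) e110)] -/
theorem IsEulerFactorAway₂.hasValueAt₂ {S : Finset (HeightOneSpectrum (𝓞 K))}
    (hB : IsEulerFactorAway₂ ι S κ₁ κ₂ g₁ g₂ f B)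
    {ρ : HeckeCharacter K} {m b : ℕ} (hm : 1 ≤ m) (hmb : m ≤ b)
    (hinf : ρ.HasInfinityType (fun _ ↦ (m : ℤ)) (fun _ ↦ -(b : ℤ)))
    (hunr : ∀ w : HeightOneSpectrum (𝓞 K), ρ.IsUnramifiedAt w)
    {r : FramedGaloisRep K (PadicAlgCl p) 1} (hr : IsPAdicAvatarOf ι ρ r)
    (hκ : FactorsThroughPair κ₁ κ₂ r) :
    IntSeries.HasValueAt₂ B (avatarValueAt r g₁ - 1) (avatarValueAt r g₂ - 1)
      ((ι.symm (∏ w ∈ S, rankinSelbergLocalFactorInvHecke f ρ w 1) : PadicAlgCl p) : ℂ_[p]) :=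
  hB ρ m b hm hmb hinf hunr r hr hκ

/-- **The CLW pair on the anticyclotomic line with an Euler-factor denominator, read on the
restriction `A(0, ·) = PowerSeries.constantCoeff A ∈ 𝒪_{ℂ_p}⟦T₂⟧`**: if `B` is the Euler-factor element
of `S` and `(A, u · B)` is a CLW pair (`u ∈ 𝒪_{ℂ_p}` a constant, e.g. `p^k`), then at a character `ρ` of
tree type `(n, −n)`, conductor `1`, with avatar `r` through the anticyclotomic `κ₂`, and `g₁ ∈ ker κ₂`,
the ONE-variable series `constantCoeff A` has at `T₂ = r(g₂) − 1` the value
`u · ι⁻¹(∏_{w∈S} P_w(f,ρ,1)) · ι⁻¹(clwInterpolationValue f 𝔭′ ρ n n Ω_∞ C) · Ω_p^{4n}` — the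
`S`-IMPRIMITIVE display of print (6.1.2) on the line `T₁ = 0`, in the currency
(`IntSeries.HasValueAt … (avatarValueAt r g₂ - 1) …`) of the tree's one-variable anticyclotomic frames
`IsHsiehLFunction` / `IsBDPLFunction` at the generator `g₂` (`IntSeries.hasValueAt₂_zero_left_iff`,
`IntSeries.HasValueAt₂.const_mul`).
[cite: CastellaLiuWan2022, (6.1.2) p. 51 and Thm. 8.2.1 p. 85 (Forum Math. Sigma 10 (2022) e110)] -/
theorem IsCastellaLiuWanLFunction₂.hasValueAt_constantCoeff_of_euler
    {S : Finset (HeightOneSpectrum (𝓞 K))} {u : PadicComplexInt p}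
    (hAB : IsCastellaLiuWanLFunction₂ ι 𝔭' κ₁ κ₂ g₁ g₂ f Ωinf C Ωp A
      (PowerSeries.C (PowerSeries.C u) * B))
    (hB : IsEulerFactorAway₂ ι S κ₁ κ₂ g₁ g₂ f B) (hg₁ : κ₂ g₁ = 1)
    {ρ : HeckeCharacter K} {n : ℕ} (hn : 1 ≤ n)
    (hinf : ρ.HasInfinityType (fun _ ↦ (n : ℤ)) (fun _ ↦ -(n : ℤ)))
    (hunr : ∀ w : HeightOneSpectrum (𝓞 K), ρ.IsUnramifiedAt w)
    {r : FramedGaloisRep K (PadicAlgCl p) 1} (hr : IsPAdicAvatarOf ι ρ r)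
    (hκ : FactorsThroughZp κ₂ r) :
    IntSeries.HasValueAt (PowerSeries.constantCoeff A) (avatarValueAt r g₂ - 1)
      (((u : PadicComplexInt p) : ℂ_[p]) *
          ((ι.symm (∏ w ∈ S, rankinSelbergLocalFactorInvHecke f ρ w 1) : PadicAlgCl p) : ℂ_[p]) *
        (((ι.symm (clwInterpolationValue f 𝔭' ρ n n Ωinf C) : PadicAlgCl p) : ℂ_[p]) *
          Ωp ^ (2 * (n + n)))) := by
  have h1 : avatarValueAt r g₁ - 1 = 0 := by
    rw [avatarValueAt_eq_one_of_factorsThroughZp hκ hg₁, sub_self]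
  have hBv := (hB.hasValueAt₂ hn le_rfl hinf hunr hr (hκ.factorsThroughPair_right κ₁)).const_mul u
  rw [h1] at hBv
  rw [← IntSeries.hasValueAt₂_zero_left_iff]
  exact hAB.hasValueAt₂_line hg₁ hn hinf hunr hr hκ hBv

/-- **The direct comparison with a Hsieh witness, value by value on the anticyclotomic line.** At a
level `N` with `p ∣ N`, `a_p(f) = 0` (the additive `E`): for a CLW pair `(A, u·B)` with Euler-factor
denominator `B` (as in `hasValueAt_constantCoeff_of_euler`) and ANY Hsieh display data
`(A′ > 0, Ω_K′ ≠ 0, C′ ≠ 0)` at the ι-prime `𝔭`, the restriction `constantCoeff A` has at the point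
`T₂ = r(g₂) − 1` of a diagonal character `ρ` (tree type `(n, −n)`, conductor `1`, avatar through `κ₂`)
the value `u · ι⁻¹(∏_{w∈S} P_w(f,ρ,1)) · ι⁻¹(R(ρ)) · Ω_p^{4n} · ι⁻¹(hsiehInterpolationValue p f 𝔭 ρ n A′
Ω_K′ C′)` with the EXPLICIT ratio `R(ρ) = ρ(ϖ_𝔭′)⁻² · C · A′^{2n} 4^{2n} π^{2n+1} Ω_K′^{4n} / (p^{n} C′
(2πi)^{2n+1} Ω_∞^{4n})` of `clwInterpolationValue_diag_eq_mul_hsiehInterpolationValue` — while a Hsieh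
witness `Q′` (`IsHsiehLFunction ι 𝔭 κ₂ g₂ f A′ Ω_K′ C′ Ω_p′ Q′`) has the value `ι⁻¹(hsiehInterpolationValue
…) · Ω_p′^{4n}` there (`IsHsiehLFunction.hasValueAt`). This is the "direct comparison of the
interpolation properties" for this branch at the level of VALUES; the passage to IDEALS of `𝒪_{ℂ_p}⟦T⟧`
(density of the diagonal points, the unit interpolating `ρ ↦ ι⁻¹(ρ(ϖ_𝔭′)⁻²) p^{−2n}`, the `n`-th powers)
is NOT a printed sentence for this branch and is not claimed.
[cite: CastellaLiuWan2022, (6.1.2) p. 51 (Forum Math. Sigma 10 (2022) e110)] [cite: Hsieh2014, Thm. A p. 712 (Doc. Math. 19) = Thm. 1 (arXiv:1112.1580 p. 4)] -/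
theorem IsCastellaLiuWanLFunction₂.hasValueAt_constantCoeff_eq_mul_hsieh
    {S : Finset (HeightOneSpectrum (𝓞 K))} {u : PadicComplexInt p} (hp : p ∣ N)
    (hap : cuspCoeff f p = 0) (𝔭 : HeightOneSpectrum (𝓞 K))
    (hAB : IsCastellaLiuWanLFunction₂ ι 𝔭' κ₁ κ₂ g₁ g₂ f Ωinf C Ωp A
      (PowerSeries.C (PowerSeries.C u) * B))
    (hB : IsEulerFactorAway₂ ι S κ₁ κ₂ g₁ g₂ f B) (hg₁ : κ₂ g₁ = 1)
    {A' : ℝ} (hA' : 0 < A') {ΩK' C' : ℂ} (hΩK' : ΩK' ≠ 0) (hC' : C' ≠ 0)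
    {ρ : HeckeCharacter K} {n : ℕ} (hn : 1 ≤ n)
    (hinf : ρ.HasInfinityType (fun _ ↦ (n : ℤ)) (fun _ ↦ -(n : ℤ)))
    (hunr : ∀ w : HeightOneSpectrum (𝓞 K), ρ.IsUnramifiedAt w)
    {r : FramedGaloisRep K (PadicAlgCl p) 1} (hr : IsPAdicAvatarOf ι ρ r)
    (hκ : FactorsThroughZp κ₂ r) :
    IntSeries.HasValueAt (PowerSeries.constantCoeff A) (avatarValueAt r g₂ - 1)
      (((u : PadicComplexInt p) : ℂ_[p]) *
          ((ι.symm (∏ w ∈ S, rankinSelbergLocalFactorInvHecke f ρ w 1) : PadicAlgCl p) : ℂ_[p]) *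
        (((ι.symm
              (((heckeValueExtZero ρ 𝔭') ^ 2)⁻¹ * C *
                  ((A' : ℂ) ^ (2 * n) * (4 : ℂ) ^ (2 * n) * (Real.pi : ℂ) ^ (2 * n + 1) *
                    ΩK' ^ (4 * n)) /
                (((p : ℂ) ^ n * C') * ((2 * Real.pi * Complex.I) ^ (2 * n + 1) * Ωinf ^ (4 * n)))) :
              PadicAlgCl p) : ℂ_[p]) *
            ((ι.symm (hsiehInterpolationValue p f 𝔭 ρ n A' ΩK' C') : PadicAlgCl p) : ℂ_[p]) *
          Ωp ^ (2 * (n + n)))) := by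
  have hp0 : p ≠ 0 := (Fact.out : p.Prime).ne_zero
  have key := clwInterpolationValue_diag_eq_mul_hsiehInterpolationValue hp0 hp f hap 𝔭 𝔭' ρ n hA'
    (Ωinf := Ωinf) hΩK' hC' C
  have hv := hAB.hasValueAt_constantCoeff_of_euler hB hg₁ hn hinf hunr hr hκ
  rw [key, map_mul] at hv
  convert hv using 2
  push_cast
  ring

/-- **The direct comparison with Castella's display (`bdpInterpolationValue`, the currency of the tree's
`IsBDPLFunction` and of the Summits-side receptacle frames), value by value on the anticyclotomic line.**
At a level `N` with `p ∣ N`, `a_p(f) = 0` (the additive `E`): for a CLW pair `(A, u·B)` with Euler-factor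
denominator `B` and ANY period `Ω_K′ ≠ 0` at the ι-prime `𝔭`, the restriction `constantCoeff A` has at
`T₂ = r(g₂) − 1` (diagonal `ρ` of tree type `(n, −n)`, conductor `1`, avatar through `κ₂`, `g₁ ∈ ker κ₂`)
the value `u · ι⁻¹(∏_{w∈S} P_w(f,ρ,1)) · (ι⁻¹(R(ρ)) · ι⁻¹(bdpInterpolationValue p f 𝔭 ρ n Ω_K′) · Ω_p^{4n})`
with the EXPLICIT ratio `R(ρ) = ρ(ϖ_𝔭′)⁻² · C · π^{2n+1} Ω_K′^{4n} / ((2πi)^{2n+1} Ω_∞^{4n})` of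
`clwInterpolationValue_diag_eq_mul_bdpInterpolationValue` (exponent written `4n` as in `IsBDPLFunction`).
Display-level comparison only; the passage to ideals is not a printed sentence for this branch and is
not claimed.
[cite: CastellaLiuWan2022, (6.1.2) p. 51 (Forum Math. Sigma 10 (2022) e110)] [cite: Castella2018, Thm. 3.1 (arXiv:1704.06608 p. 9)] -/
theorem IsCastellaLiuWanLFunction₂.hasValueAt_constantCoeff_eq_mul_bdp
    {S : Finset (HeightOneSpectrum (𝓞 K))} {u : PadicComplexInt p} (hp : p ∣ N)
    (hap : cuspCoeff f p = 0) (𝔭 : HeightOneSpectrum (𝓞 K))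
    (hAB : IsCastellaLiuWanLFunction₂ ι 𝔭' κ₁ κ₂ g₁ g₂ f Ωinf C Ωp A
      (PowerSeries.C (PowerSeries.C u) * B))
    (hB : IsEulerFactorAway₂ ι S κ₁ κ₂ g₁ g₂ f B) (hg₁ : κ₂ g₁ = 1)
    {ΩK' : ℂ} (hΩK' : ΩK' ≠ 0)
    {ρ : HeckeCharacter K} {n : ℕ} (hn : 1 ≤ n)
    (hinf : ρ.HasInfinityType (fun _ ↦ (n : ℤ)) (fun _ ↦ -(n : ℤ)))
    (hunr : ∀ w : HeightOneSpectrum (𝓞 K), ρ.IsUnramifiedAt w)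
    {r : FramedGaloisRep K (PadicAlgCl p) 1} (hr : IsPAdicAvatarOf ι ρ r)
    (hκ : FactorsThroughZp κ₂ r) :
    IntSeries.HasValueAt (PowerSeries.constantCoeff A) (avatarValueAt r g₂ - 1)
      (((u : PadicComplexInt p) : ℂ_[p]) *
          ((ι.symm (∏ w ∈ S, rankinSelbergLocalFactorInvHecke f ρ w 1) : PadicAlgCl p) : ℂ_[p]) *
        (((ι.symm
              (((heckeValueExtZero ρ 𝔭') ^ 2)⁻¹ * C * ((Real.pi : ℂ) ^ (2 * n + 1) * ΩK' ^ (4 * n)) /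
                ((2 * Real.pi * Complex.I) ^ (2 * n + 1) * Ωinf ^ (4 * n))) :
              PadicAlgCl p) : ℂ_[p]) *
            ((ι.symm (bdpInterpolationValue p f 𝔭 ρ n ΩK') : PadicAlgCl p) : ℂ_[p]) *
          Ωp ^ (4 * n))) := by
  have key := clwInterpolationValue_diag_eq_mul_bdpInterpolationValue hp f hap 𝔭 𝔭' ρ n
    (Ωinf := Ωinf) hΩK' C
  have hv := hAB.hasValueAt_constantCoeff_of_euler hB hg₁ hn hinf hunr hr hκ
  rw [key, map_mul] at hv
  convert hv using 2
  push_cast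
  ring

end API

end Literature.NumberTheory.EllipticCurves.CastellaLiuWan2022

end
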